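import Summits.NavierStokesRegularity.NavierStokesRegularity.Theses.HodographBetchov

/-!
# `FastClassSqueeze` is false without the energy class (the Leray–Hopf hypothesis is load-bearing)

Negative-side support for the crux `FastClassSqueeze` (stmt-NavierStokesRegularity-15832, route
`HodographBetchov`, rank 3), refuter crux-attack at vetting (2026-08-17). Theorems and the explicit
witness only; nothing here asserts a Theses statement.

The crux says: along every classical solution `(u, p)` of unforced Navier–Stokes on `ℝ³ × [0,T)` that is
Leray–Hopf from a rapidly decaying datum there are a speed level `l > 0`, an exponent `q > 3/2` and a
nonnegative min–max majorant `m` of the middle strain eigenvalue on the fast class `{|u| > l}` with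
`∫₀ᵀ (∫_{|u|>l} m^q)^{2/(2q−3)} < ∞`.

`fastClassSqueeze_false_without_lerayHopf`: with the single hypothesis `IsLerayHopfOn T ν 0 (u 0) u`
deleted — and nothing else changed, in particular KEEPING the rapidly decaying datum — the statement is
FALSE. Witness (`ν = T = 1`): the biaxial strain flow from rest `u(t, x) = t (x₀, x₁, −2x₂)`,
`p = −½(1 + t²)(x₀² + x₁²) + (1 − 2t²)x₂²` (Majda–Bertozzi 2002, §1.4: exact solutions with linear
velocity; KNSS 2009, §1: parasitic infinite-energy solutions from the datum `0`). It is classical on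
`[0, 1) × ℝ³` for every viscosity (`biaxVel_isClassical`), `u(0) = 0` is rapidly decaying, and it is GLOBAL and
smooth — no blow-up is involved: the min–max clause forces `m(t, x) ≥ t` at every fast point (the middle
eigenvalue of `t·diag(1, 1, −2)` is `+t`: every 2-plane meets the plane `{ξ₂ = 0}`, on which the form is
`t‖ξ‖²`, `le_of_plane`), while the fast class `{|u(t)| > l} ⊇ {‖x‖ > l/t}` has infinite volume
(`volume_fast_eq_top`), so the inner integral is `∞` for every `t ∈ (0, 1)` and the mixed norm is `∞` for
every admissible `(l, q, m)`.

Information for provers: (i) the min–max clause is honest — `m` cannot be taken `0` where the strain is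
biaxial (`λ₂ > 0`), so the integrability conclusion is not junk-satisfiable; (ii) the ONLY a-priori control
of the fast class is its measure `|F_l(t)| ≤ 2E₀/l²` from the energy class, and any proof must use it;
(iii) by contrast, for a solution bounded on `[0,T) × ℝ³` the conclusion is trivial (`l > sup |u|`, empty
fast class), so the crux's content sits entirely in the (unknown) blow-up scenario.
[cite: MajdaBertozzi2002, §1.4 (exact solutions with linear velocity field)]
[cite: KochNadirashviliSereginSverak2009, §1 p. 3 (parasitic solutions)]
-/

noncomputable section

namespace Summit.NavierStokesRegularity.NavierStokesRegularity.Theorems.FastClassSqueeze.Negative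

open MeasureTheory Set Filter Metric InnerProductSpace
open scoped ENNReal RealInnerProductSpace ContDiff Laplacian
open Literature.Analysis.FluidPDE

local notation "ℝ³" => EuclideanSpace ℝ (Fin 3)

/-- `e₀ = (1, 0, 0)`. -/
def ex : ℝ³ := EuclideanSpace.single 0 1

/-- `e₁ = (0, 1, 0)`. -/
def ey : ℝ³ := EuclideanSpace.single 1 1

/-- `e₂ = (0, 0, 1)`. -/
def ez : ℝ³ := EuclideanSpace.single 2 1

/-- The axisymmetric (biaxial) strain `B x = x − 3 x₂ e₂ = (x₀, x₁, −2 x₂)`: symmetric, trace free,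
eigenvalues `1, 1, −2`, so its MIDDLE eigenvalue is `+1`. -/
def strainB : ℝ³ →L[ℝ] ℝ³ := ContinuousLinearMap.id ℝ ℝ³ - (3 : ℝ) • (innerSL ℝ ez).smulRight ez

/-- `B x = x − 3 x₂ e₂`. [folklore] -/
theorem strainB_apply (x : ℝ³) : strainB x = x - (3 * x 2) • ez := by
  simp [strainB, ez, ContinuousLinearMap.smulRight_apply, EuclideanSpace.inner_single_left, smul_smul]

/-- Coordinates of `B x = (x₀, x₁, −2x₂)`. [folklore] -/
@[simp] theorem strainB_apply_zero (x : ℝ³) : strainB x 0 = x 0 := by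
  simp [strainB_apply, ez]

/-- Coordinates of `B x = (x₀, x₁, −2x₂)`. [folklore] -/
@[simp] theorem strainB_apply_one (x : ℝ³) : strainB x 1 = x 1 := by
  simp [strainB_apply, ez]

/-- Coordinates of `B x = (x₀, x₁, −2x₂)`. [folklore] -/
@[simp] theorem strainB_apply_two (x : ℝ³) : strainB x 2 = -2 * x 2 := by
  simp [strainB_apply, ez]
  ring

/-- `B² x = x + 3 x₂ e₂ = (x₀, x₁, 4x₂)`. [folklore] -/
theorem strainB_strainB (x : ℝ³) : strainB (strainB x) = x + (3 * x 2) • ez := by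
  ext i
  fin_cases i <;> simp [strainB_apply, ez]
  ring

/-- `‖x‖ ≤ ‖B x‖` (`‖Bx‖² = x₀² + x₁² + 4x₂²`). [folklore] -/
theorem norm_le_norm_strainB (x : ℝ³) : ‖x‖ ≤ ‖strainB x‖ := by
  rw [EuclideanSpace.norm_eq x, EuclideanSpace.norm_eq (strainB x)]
  apply Real.sqrt_le_sqrt
  simp only [Fin.sum_univ_three, strainB_apply_zero, strainB_apply_one, strainB_apply_two,
    Real.norm_eq_abs, sq_abs]
  nlinarith [sq_nonneg (x 2)]

/-- On the plane `{ξ₂ = 0}` the strain acts as the identity: `⟪B ξ, ξ⟫ = ‖ξ‖²`. [folklore] -/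
theorem inner_strainB_self {ξ : ℝ³} (h : ξ 2 = 0) : ⟪strainB ξ, ξ⟫ = ‖ξ‖ ^ 2 := by
  rw [strainB_apply, h, mul_zero, zero_smul, sub_zero, real_inner_self_eq_norm_sq]

/-- The Laplacian of a linear field vanishes. [folklore] -/
theorem laplacian_clm (L : ℝ³ →L[ℝ] ℝ³) (x : ℝ³) : (Δ (L : ℝ³ → ℝ³)) x = 0 := by
  rw [laplacian_eq_iteratedFDeriv_orthonormalBasis (L : ℝ³ → ℝ³) (EuclideanSpace.basisFun (Fin 3) ℝ)]
  have hf : fderiv ℝ (L : ℝ³ → ℝ³) = fun _ => L := funext fun y => L.fderiv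
  simp [iteratedFDeriv_two_apply, hf]

/-! ## The biaxial strain flow `u = t B x` from rest -/

/-- The velocity `u(t, x) = t B x = t (x₀, x₁, −2x₂)` (irrotational, harmonic, divergence free,
datum `u(0) = 0`). -/
def biaxVel : ℝ → ℝ³ → ℝ³ := fun t x => t • strainB x

/-- The pressure `p(t, x) = −½(1 + t²)(x₀² + x₁²) + (1 − 2t²) x₂²` (`= −½ xᵀ(Ṁ + M²)x` for `M = t B`;
Majda–Bertozzi 2002, §1.4). -/
def biaxPres : ℝ → ℝ³ → ℝ := fun t x =>
  -((1 + t ^ 2) / 2) * ((x 0) ^ 2 + (x 1) ^ 2) + (1 - 2 * t ^ 2) * (x 2) ^ 2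

/-- The time slices of the flow are the linear maps `t B`. [folklore] -/
theorem biaxVel_eq (t : ℝ) : biaxVel t = ⇑(t • strainB) := rfl

/-- The flow starts from rest. [folklore] -/
theorem biaxVel_zero : biaxVel 0 = 0 := by
  funext x
  simp [biaxVel]

/-- `∇u(t) ≡ t B`. [folklore] -/
theorem fderiv_biaxVel (t : ℝ) (x : ℝ³) : fderiv ℝ (biaxVel t) x = t • strainB := by
  rw [biaxVel_eq, ContinuousLinearMap.fderiv]

/-- `‖u(t, x)‖ = |t| ‖B x‖ ≥ |t| ‖x‖`. [folklore] -/
theorem abs_mul_norm_le_norm_biaxVel (t : ℝ) (x : ℝ³) : |t| * ‖x‖ ≤ ‖biaxVel t x‖ := by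
  rw [biaxVel, norm_smul, Real.norm_eq_abs]
  exact mul_le_mul_of_nonneg_left (norm_le_norm_strainB x) (abs_nonneg t)

/-- The derivative of the quadratic pressure slice. [folklore] -/
theorem hasFDerivAt_biaxPres (t : ℝ) (x : ℝ³) :
    HasFDerivAt (biaxPres t)
      ((-((1 + t ^ 2) / 2)) • ((2 • (x 0) ^ (2 - 1)) • (EuclideanSpace.proj 0 : ℝ³ →L[ℝ] ℝ) +
          (2 • (x 1) ^ (2 - 1)) • (EuclideanSpace.proj 1 : ℝ³ →L[ℝ] ℝ)) +
        (1 - 2 * t ^ 2) • ((2 • (x 2) ^ (2 - 1)) • (EuclideanSpace.proj 2 : ℝ³ →L[ℝ] ℝ))) x := by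
  have h0 : HasFDerivAt (fun y : ℝ³ => y 0) (EuclideanSpace.proj 0 : ℝ³ →L[ℝ] ℝ) x :=
    PiLp.hasFDerivAt_apply 2 x 0
  have h1 : HasFDerivAt (fun y : ℝ³ => y 1) (EuclideanSpace.proj 1 : ℝ³ →L[ℝ] ℝ) x :=
    PiLp.hasFDerivAt_apply 2 x 1
  have h2 : HasFDerivAt (fun y : ℝ³ => y 2) (EuclideanSpace.proj 2 : ℝ³ →L[ℝ] ℝ) x :=
    PiLp.hasFDerivAt_apply 2 x 2
  exact (((h0.pow 2).add (h1.pow 2)).const_mul _).add ((h2.pow 2).const_mul _)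

/-- `∇p(t, x) = −(1 + t²) x₀ e₀ − (1 + t²) x₁ e₁ + 2(1 − 2t²) x₂ e₂`. [folklore] -/
theorem gradient_biaxPres (t : ℝ) (x : ℝ³) :
    gradient (biaxPres t) x =
      (-(1 + t ^ 2) * x 0) • ex + (-(1 + t ^ 2) * x 1) • ey + (2 * (1 - 2 * t ^ 2) * x 2) • ez := by
  have hP : HasFDerivAt (biaxPres t)
      (InnerProductSpace.toDual ℝ ℝ³
        ((-(1 + t ^ 2) * x 0) • ex + (-(1 + t ^ 2) * x 1) • ey + (2 * (1 - 2 * t ^ 2) * x 2) • ez)) x := by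
    refine (hasFDerivAt_biaxPres t x).congr_fderiv (ContinuousLinearMap.ext fun h => ?_)
    simp only [add_apply, FunLike.coe_smul, Pi.smul_apply,
      InnerProductSpace.toDual_apply_apply, inner_add_left, inner_smul_left, ex, ey, ez,
      EuclideanSpace.inner_single_left, smul_eq_mul, map_one, one_mul, conj_trivial, pow_one,
      Nat.add_one_sub_one, nsmul_eq_mul, Nat.cast_ofNat, PiLp.proj_apply]
    ring
  exact (hasGradientAt_iff_hasFDerivAt.mpr hP).gradient

/-- `div u(t) = t tr B = 0`. [folklore] -/
theorem divergence_biaxVel (t : ℝ) (x : ℝ³) : VectorCalculus.divergence (biaxVel t) x = 0 := by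
  rw [divergence_eq_sum_inner_fderiv (EuclideanSpace.basisFun (Fin 3) ℝ), fderiv_biaxVel,
    Fin.sum_univ_three]
  simp only [EuclideanSpace.basisFun_apply, EuclideanSpace.inner_single_left, map_one, one_mul,
    FunLike.coe_smul, Pi.smul_apply, PiLp.smul_apply, smul_eq_mul,
    strainB_apply_zero, strainB_apply_one, strainB_apply_two, PiLp.single_apply]
  simp
  ring

/-- **The biaxial strain flow from rest is a classical solution** of unforced Navier–Stokes on
`[0, 1) × ℝ³`, for every viscosity: `∂ₜu = B x`, `(u·∇)u = t² B² x`, `Δu = 0`,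
`−∇p = B x + t² B² x`, `div u = 0` (Majda–Bertozzi 2002, §1.4, exact solutions with linear velocity).
[cite: MajdaBertozzi2002, §1.4 (exact solutions with linear velocity field)] -/
theorem biaxVel_isClassical (ν : ℝ) : IsClassicalNSSolutionOn (Ico 0 1) ν 0 biaxVel biaxPres where
  smooth_velocity := by
    show ContDiffOn ℝ ∞ (fun z : ℝ × ℝ³ => z.1 • strainB z.2) (Ico 0 1 ×ˢ univ)
    exact (contDiff_fst.smul (strainB.contDiff.comp contDiff_snd)).contDiffOn
  smooth_pressure := by
    show ContDiffOn ℝ ∞ (fun z : ℝ × ℝ³ => -((1 + z.1 ^ 2) / 2) * ((z.2 0) ^ 2 + (z.2 1) ^ 2) +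
      (1 - 2 * z.1 ^ 2) * (z.2 2) ^ 2) (Ico 0 1 ×ˢ univ)
    have ht : ContDiff ℝ ∞ (fun z : ℝ × ℝ³ => z.1) := contDiff_fst
    have h0 : ContDiff ℝ ∞ (fun z : ℝ × ℝ³ => z.2 0) :=
      (contDiff_piLp_apply (p := 2) (i := (0 : Fin 3))).comp contDiff_snd
    have h1 : ContDiff ℝ ∞ (fun z : ℝ × ℝ³ => z.2 1) :=
      (contDiff_piLp_apply (p := 2) (i := (1 : Fin 3))).comp contDiff_snd
    have h2 : ContDiff ℝ ∞ (fun z : ℝ × ℝ³ => z.2 2) :=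
      (contDiff_piLp_apply (p := 2) (i := (2 : Fin 3))).comp contDiff_snd
    exact (((((contDiff_const.add (ht.pow 2)).div_const 2).neg.mul ((h0.pow 2).add (h1.pow 2))).add
      ((contDiff_const.sub (contDiff_const.mul (ht.pow 2))).mul (h2.pow 2))).contDiffOn)
  momentum t ht x := by
    have hderiv : timeDerivWithin (Ico 0 1) biaxVel t x = strainB x := by
      simp only [timeDerivWithin_apply, biaxVel]
      have h := (hasDerivAt_id' t).smul_const (strainB x)
      rw [one_smul] at h
      exact h.hasDerivWithinAt.derivWithin (uniqueDiffOn_Ico 0 1 t ht)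
    have hconv : convect (biaxVel t) (biaxVel t) x = (t * t) • (x + (3 * x 2) • ez) := by
      rw [convect_apply, fderiv_biaxVel, biaxVel_eq, smul_apply, smul_apply, map_smul, strainB_strainB,
        smul_smul]
    have hlap : (Δ (biaxVel t)) x = 0 := by
      rw [biaxVel_eq]
      exact laplacian_clm _ x
    rw [hderiv, hconv, hlap, gradient_biaxPres, strainB_apply]
    ext i
    fin_cases i <;> simp [ex, ey, ez] <;> ring
  divFree t _ x := divergence_biaxVel t x

/-- The flow starts from the datum `0`, which is rapidly decaying. [folklore] -/
theorem biaxVel_rapidDecay : HasRapidSpatialDecay (biaxVel 0) := by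
  rw [biaxVel_zero]
  intro n K
  refine ⟨0, fun x => ?_⟩
  have h : (0 : ℝ³ → ℝ³) = fun _ => (0 : ℝ³) := rfl
  rw [h, iteratedFDeriv_fun_zero]
  simp

/-! ## The min–max clause forces `m ≥ t`; the fast class has infinite volume -/

/-- **The middle eigenvalue of `t B` is `+t`.** If on some orthonormal 2-frame `v, w` the quadratic form of
`∇u(t, x) = t B` is bounded by `m (α² + β²)`, then `t ≤ m`: the frame's plane contains a unit vector `ξ`
with `ξ₂ = 0` (`ξ ∝ w₂ v − v₂ w`, or `ξ = v` if `v₂ = 0`), and there `⟪t B ξ, ξ⟫ = t ‖ξ‖²`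
(Courant–Fischer for `diag(t, t, −2t)`). [folklore] -/
theorem le_of_plane {t m : ℝ} {x : ℝ³}
    (h : ∃ v w : ℝ³, ‖v‖ = 1 ∧ ‖w‖ = 1 ∧ ⟪v, w⟫ = 0 ∧
      ∀ α β : ℝ, ⟪fderiv ℝ (biaxVel t) x (α • v + β • w), α • v + β • w⟫ ≤ m * (α ^ 2 + β ^ 2)) :
    t ≤ m := by
  obtain ⟨v, w, hv, hw, hvw, hle⟩ := h
  have key : ∀ α β : ℝ, (α • v + β • w) 2 = 0 → t * (α ^ 2 + β ^ 2) ≤ m * (α ^ 2 + β ^ 2) := by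
    intro α β hξ
    have hnorm : ‖α • v + β • w‖ ^ 2 = α ^ 2 + β ^ 2 := by
      rw [norm_add_sq_real, real_inner_smul_left, real_inner_smul_right, hvw, norm_smul, norm_smul,
        hv, hw]
      simp [sq_abs]
    have h1 := hle α β
    rw [fderiv_biaxVel, smul_apply, real_inner_smul_left, inner_strainB_self hξ, hnorm] at h1
    exact h1
  by_cases hv2 : v 2 = 0
  · have h1 := key 1 0 (by simp [hv2])
    simpa using h1
  · have h1 := key (w 2) (-(v 2)) (by simp; ring)
    have hpos : 0 < (w 2) ^ 2 + (-(v 2)) ^ 2 :=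
      add_pos_of_nonneg_of_pos (sq_nonneg _)
        (lt_of_le_of_ne (sq_nonneg _) (Ne.symm (pow_ne_zero 2 (neg_ne_zero.2 hv2))))
    exact le_of_mul_le_mul_right h1 hpos

/-- **The fast class of the strain flow has infinite volume**: for `t > 0` and every level `l`,
`{x : l < ‖u(t, x)‖} ⊇ {x : l/t < ‖x‖}`, the complement of a ball in `ℝ³` (Lebesgue measure of `ℝ³` is
infinite, Mathlib `measure_univ_of_isAddLeftInvariant`). [folklore] -/
theorem volume_fast_eq_top {t : ℝ} (l : ℝ) (ht : 0 < t) :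
    volume {x : ℝ³ | l < ‖biaxVel t x‖} = ⊤ := by
  have hsub : (closedBall (0 : ℝ³) (l / t))ᶜ ⊆ {x : ℝ³ | l < ‖biaxVel t x‖} := by
    intro x hx
    rw [mem_compl_iff, mem_closedBall, dist_zero_right, not_le] at hx
    show l < ‖biaxVel t x‖
    have h1 : l < t * ‖x‖ := by rwa [div_lt_iff₀' ht] at hx
    calc l < t * ‖x‖ := h1
      _ = |t| * ‖x‖ := by rw [abs_of_pos ht]
      _ ≤ ‖biaxVel t x‖ := abs_mul_norm_le_norm_biaxVel t x
  have hfin : volume (closedBall (0 : ℝ³) (l / t)) ≠ ⊤ := (isCompact_closedBall _ _).measure_lt_top.ne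
  have huniv : volume (univ : Set ℝ³) ≤
      volume (closedBall (0 : ℝ³) (l / t)) + volume (closedBall (0 : ℝ³) (l / t))ᶜ := by
    rw [← union_compl_self (closedBall (0 : ℝ³) (l / t))]
    exact measure_union_le _ _
  rw [measure_univ_of_isAddLeftInvariant, top_le_iff, ENNReal.add_eq_top] at huniv
  exact top_le_iff.mp ((huniv.resolve_left hfin) ▸ measure_mono hsub)

/-! ## The crux without the energy class is false -/

/-- **Finite energy is load-bearing for `FastClassSqueeze`.** The crux
`HodographBetchov.FastClassSqueeze` with its hypothesis `IsLerayHopfOn T ν 0 (u 0) u` deleted — and nothing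
else changed — is FALSE: at `ν = T = 1` the biaxial strain flow from rest `u = t (x₀, x₁, −2x₂)`
(`biaxVel_isClassical`, datum `0` rapidly decaying, `biaxVel_rapidDecay`) admits no level `l`, exponent `q > 3/2`
and min–max majorant `m` with finite mixed norm: `m ≥ t` on the fast class (`le_of_plane`), whose volume is
infinite (`volume_fast_eq_top`), so `∫_{|u(t)|>l} m^q = ∞` for every `t ∈ (0, 1)` and the time integral is
`∞`. No blow-up is involved (the flow is global and smooth); the energy class enters the crux exactly
through `|{|u(t)| > l}| ≤ 2E₀/l²`. [cite: MajdaBertozzi2002, §1.4 (exact solutions with linear velocity field)] -/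
theorem fastClassSqueeze_false_without_lerayHopf :
    ¬ (∀ (ν T : ℝ), 0 < ν → 0 < T → ∀ (u : ℝ → ℝ³ → ℝ³) (p : ℝ → ℝ³ → ℝ),
        IsClassicalNSSolutionOn (Set.Ico 0 T) ν 0 u p → HasRapidSpatialDecay (u 0) →
        ∃ l : ℝ, 0 < l ∧ ∃ q : ℝ, 3 / 2 < q ∧ ∃ m : ℝ → ℝ³ → ℝ, (∀ t x, 0 ≤ m t x) ∧
          (∀ t ∈ Set.Ico 0 T, ∀ x, l < ‖u t x‖ → ∃ v w : ℝ³, ‖v‖ = 1 ∧ ‖w‖ = 1 ∧ inner ℝ v w = 0 ∧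
            ∀ α β : ℝ, inner ℝ (fderiv ℝ (u t) x (α • v + β • w)) (α • v + β • w) ≤
              m t x * (α ^ 2 + β ^ 2)) ∧
          ∫⁻ t in Set.Ioo 0 T, (∫⁻ x in {x : ℝ³ | l < ‖u t x‖}, ENNReal.ofReal (m t x) ^ q) ^
            (2 / (2 * q - 3)) < ⊤) := by
  intro h
  obtain ⟨l, -, q, hq, m, -, hplane, hint⟩ :=
    h 1 1 one_pos one_pos biaxVel biaxPres (biaxVel_isClassical 1) biaxVel_rapidDecay
  have hq0 : 0 < q := by linarith
  have hexp : 0 < 2 / (2 * q - 3) := div_pos two_pos (by linarith)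
  -- for every `t ∈ (0, 1)` the inner (fast-class) integral is `∞`
  have hinner : ∀ t ∈ Ioo (0 : ℝ) 1,
      (∫⁻ x in {x : ℝ³ | l < ‖biaxVel t x‖}, ENNReal.ofReal (m t x) ^ q) = ⊤ := by
    intro t ht
    have hc : Continuous fun x : ℝ³ => ‖biaxVel t x‖ := (strainB.continuous.const_smul t).norm
    have hmeas : MeasurableSet {x : ℝ³ | l < ‖biaxVel t x‖} := measurableSet_lt measurable_const hc.measurable
    have hle : ∀ x ∈ {x : ℝ³ | l < ‖biaxVel t x‖}, ENNReal.ofReal t ^ q ≤ ENNReal.ofReal (m t x) ^ q := by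
      intro x hx
      have htm : t ≤ m t x := le_of_plane (hplane t ⟨ht.1.le, ht.2⟩ x hx)
      exact ENNReal.rpow_le_rpow (ENNReal.ofReal_le_ofReal htm) hq0.le
    have h1 : ∫⁻ x in {x : ℝ³ | l < ‖biaxVel t x‖}, ENNReal.ofReal t ^ q ≤
        ∫⁻ x in {x : ℝ³ | l < ‖biaxVel t x‖}, ENNReal.ofReal (m t x) ^ q :=
      setLIntegral_mono' hmeas hle
    have hne : ENNReal.ofReal t ^ q ≠ 0 :=
      (ENNReal.rpow_pos (ENNReal.ofReal_pos.2 ht.1) ENNReal.ofReal_ne_top).ne'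
    rw [setLIntegral_const, volume_fast_eq_top l ht.1, ENNReal.mul_top hne] at h1
    exact top_le_iff.mp h1
  -- hence the time integrand is `∞` on `(0, 1)` and so is the time integral
  have houter : ∫⁻ t in Ioo (0 : ℝ) 1, (∫⁻ x in {x : ℝ³ | l < ‖biaxVel t x‖},
      ENNReal.ofReal (m t x) ^ q) ^ (2 / (2 * q - 3)) = ⊤ := by
    have h2 : ∫⁻ _ in Ioo (0 : ℝ) 1, (⊤ : ℝ≥0∞) ≤ ∫⁻ t in Ioo (0 : ℝ) 1,
        (∫⁻ x in {x : ℝ³ | l < ‖biaxVel t x‖}, ENNReal.ofReal (m t x) ^ q) ^ (2 / (2 * q - 3)) :=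
      setLIntegral_mono' measurableSet_Ioo fun t ht => by
        rw [hinner t ht, ENNReal.top_rpow_of_pos hexp]
    rw [setLIntegral_const, Real.volume_Ioo, sub_zero, ENNReal.ofReal_one, mul_one] at h2
    exact top_le_iff.mp h2
  rw [houter] at hint
  exact lt_irrefl _ hint

end Summit.NavierStokesRegularity.NavierStokesRegularity.Theorems.FastClassSqueeze.Negative

end
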